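import Mathlib
import Summits.ResolutionOfSingularities.ResolutionOfSingularities.Theorems.WildQuotientsWildQuotientResolutionJordanFourTwistEngine
import Summits.ResolutionOfSingularities.ResolutionOfSingularities.Theorems.WildQuotientsWildQuotientResolutionJordanFourTwistedChartInvariants
import Summits.ResolutionOfSingularities.ResolutionOfSingularities.Theorems.WildQuotientsWildQuotientResolutionJordanFourTwistedChartInjective
import Summits.ResolutionOfSingularities.ResolutionOfSingularities.Theorems.WildQuotientsWildQuotientResolutionJordanFourParity
import Summits.ResolutionOfSingularities.ResolutionOfSingularities.Theorems.WildQuotientsWildQuotientResolutionJordanFourI6Memberships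

/-!
# V4U T2(b), INSTANCE OF RECORD: the chart ring of `Bl_{I₆} 𝔸ⁿ` at `T′`, localised at `θ`, IS `E_Q` through the twisted chart `ψ_T`

(crux stmt-ResolutionOfSingularities-15640 `WildQuotients.WildQuotientResolution`, line `Sketch`,
sector `|G| = p`; programme V4U of `L/w45c/CHAIN.md` v7.7 §4 — res-L1-w45c-plan-1's named object
2026-08-27T07:13:11Z (a) for row stub-1 «the INSTANCE one-liner at `ψ := twistedChart` with every
hypothesis discharged»; design of record `L/w45c/V4U-DESIGN.md` §3/§6 T2(b); the engine is
res-L1-w45c-stub-2's `JordanFour.exists_ringEquiv_of_twistData` (…JordanFourTwistEngine), whose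
letters `Qp`, `Egens`, `L_Q`, `E_Q`, `B_T`, `θ` (= stub-2's SIG 2026-08-27T04:59:20Z) are used
LITERALLY below. [OURS · L1 W4.5c] — NOT a statement of any manuscript; replaces the role of no
printed item. Prover res-L1-w45c-stub-1.)

* `JordanFour.exists_chartT_ringEquiv_twistedChart` — for ANY localisation `C` of the Rees chart ring
  `B_T = (k[x][I₆t])_{(T′t)}` at `θ = (H′³t²)/(T′t)²`: `C ≃+* E_Q = k[s², sA, sξ, A², Aξ, ξ², η, …][1/Q]
  ⊆ k[x][1/Q]` with `F/1 ↦ ψ_T F`, `(g_jt)/(T′t) ↦ q_j/Q` (`q = twistedCofactor`), `θ ↦ Q`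
  (`T′ = JordanFour.tPrime`, `H′ = JordanFour.hPrime`, the vocabulary of `JordanFour.chartW`, p504103).
  Every hypothesis of the engine is discharged from the tree: injectivity (p503042), `ψ_T T′ = s⁶Q`,
  `ψ_T H′³ = Q(s⁶Q)²` (p500124), `ψ_T g_j = s⁶q_j` (p499653), evenness (p501208), passengers, and the
  INVERSE DICTIONARY (`s² ↤ T′H′²`, `sA ↤ x_aH′T′`, `sξ ↤ MH′T′`, `A² ↤ x_a²`, `Aξ ↤ x_aM`, `ξ² ↤ M²`,
  `η ↤ Δ₇`) from T-iii/T-v (p500124) and the membership table `JordanFour.I6Table.*`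
  (res-L1-w45c-stub-4, p506114).
* `JordanFour.exists_chartW_away_ringEquiv_twistedChart` — the specialisation to
  `C := (k[x][I₆t])_{(T′t · H′³t²)}`, the homogeneous localisation at the section defining
  `JordanFour.chartW = D₊(T′t · H′³t²)` (Mathlib `HomogeneousLocalization.Away.isLocalization_mul`),
  with the base values in the `fromZeroRingHom ∘ zeroRingHom` form of the seam (res-type-036 / stub-5).
* helpers `twistedQ_eq_engineQ` (`twistedQ = 1 − 3·X b·X a + X a²·X d` literally),
  `adjoin_engineGens_eq_adjoin_evenGens`, `isLocalizationElem_eq_theta`, `isLocalization_away_theta_chartW`,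
  `awayMap_reesChartBase`.
-/

-- single-problem summit: the doubled namespace component `ResolutionOfSingularities` is forced
set_option linter.dupNamespace false

noncomputable section

open MvPolynomial IsLocalization Polynomial HomogeneousLocalization Literature.AlgebraicGeometry.Resolution

namespace Summit.ResolutionOfSingularities.ResolutionOfSingularities.Theorems.WildQuotientResolution.JordanFour

variable (k : Type) [Field k] (n : ℕ) (a b c d : Fin n)
  (hab : a ≠ b) (hac : a ≠ c) (had : a ≠ d) (hbc : b ≠ c) (hbd : b ≠ d) (hcd : c ≠ d)

local notation3 "gI6" => (![X a ^ 2, X a * X b ^ 2, X a * X b * X c, X a * X c ^ 3, X b ^ 3,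
  X b ^ 2 * X c ^ 2, X b * X c ^ 4, X c ^ 6] : Fin 8 → MvPolynomial (Fin n) k)
local notation3 "I6" => Ideal.span (Set.range gI6)
local notation3 "Qp" => (1 - 3 * X b * X a + X a ^ 2 * X d : MvPolynomial (Fin n) k)
local notation3 "Egens" => (({X b ^ 2, X b * X a, X b * X c, X a ^ 2, X a * X c, X c ^ 2} :
    Set (MvPolynomial (Fin n) k)) ∪ (fun i : Fin n => (X i : MvPolynomial (Fin n) k)) '' {i | i ≠ a ∧ i ≠ b ∧ i ≠ c})
local notation3 "LQ" => Localization.Away Qp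
local notation3 "EQ" => Algebra.adjoin k ((algebraMap (MvPolynomial (Fin n) k) LQ) '' Egens ∪
    {(IsLocalization.Away.invSelf Qp : LQ)})
local notation3 "BT" => HomogeneousLocalization.Away (reesGrading I6)
    (reesT (tPrime k n a b c d) (tPrime_mem_I6 k n a b c d))
local notation3 (prettyPrint := false) "θT" =>
  HomogeneousLocalization.Away.mk (reesGrading I6) (reesT_mem (tPrime k n a b c d) (tPrime_mem_I6 k n a b c d)) 2
    (⟨monomial 2 (hPrime k n a b c ^ 3), reesAlgebra.monomial_mem.mpr (hPrime_cube_mem_I6_sq k n a b c)⟩ :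
      reesAlgebra I6)
    (monomial_two_mem_reesGrading k n
      (![X a ^ 2, X a * X b ^ 2, X a * X b * X c, X a * X c ^ 3, X b ^ 3, X b ^ 2 * X c ^ 2, X b * X c ^ 4,
        X c ^ 6] : Fin 8 → MvPolynomial (Fin n) k) (hPrime k n a b c ^ 3) (hPrime_cube_mem_I6_sq k n a b c))
local notation3 "BW" => HomogeneousLocalization.Away (reesGrading I6)
    (reesT (tPrime k n a b c d) (tPrime_mem_I6 k n a b c d) * hCubeT2 k n a b c)

/-! ## The letters of the engine against the vocabulary of record -/

/-- `Q` of record (`JordanFour.twistedQ`, p499121) is the engine's literal `1 − 3·X b·X a + X a²·X d`.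
[OURS · L1 W4.5c] -/
theorem twistedQ_eq_engineQ : twistedQ k n a b d = Qp := by
  simp only [twistedQ]; ring

/-- The engine's literal even generating set generates the same subalgebra as `JordanFour.evenGens`
(p501208; the two sets coincide, `X b * X a = X a * X b`). [OURS · L1 W4.5c] -/
theorem adjoin_engineGens_eq_adjoin_evenGens :
    Algebra.adjoin k Egens = Algebra.adjoin k (evenGens k n a b c) := by
  have hset : (({X b ^ 2, X b * X a, X b * X c, X a ^ 2, X a * X c, X c ^ 2} :
      Set (MvPolynomial (Fin n) k)) ∪
        (fun i : Fin n => (X i : MvPolynomial (Fin n) k)) '' {i | i ≠ a ∧ i ≠ b ∧ i ≠ c}) =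
      evenGens k n a b c := by
    rw [show (X b * X a : MvPolynomial (Fin n) k) = X a * X b from mul_comm _ _]
    simp only [evenGens]
    ext f
    simp only [Set.mem_union, Set.mem_insert_iff, Set.mem_singleton_iff]
    tauto
  rw [hset]

/-! ## T2(b) at `ψ := ψ_T` -/

include hab hac had hbc hbd hcd in
/-- **T2(b), instance of record.** Let `B_T = (k[x][I₆t])_{(T′t)}` be the Rees chart ring of
`Bl_{I₆} 𝔸ⁿ` at `T′ = JordanFour.tPrime`, `θ = (H′³t²)/(T′t)² ∈ B_T` (`H′ = JordanFour.hPrime`), and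
`C` ANY localisation of `B_T` at `θ` (e.g. the sections over `W_T = D₊(T′t·H′³t²) = JordanFour.chartW`).
Then, in characteristic `≠ 2, 3`, `C ≃+* E_Q := k[s², sA, sξ, A², Aξ, ξ², (xᵢ)_{i ∉ {a,b,c}}][1/Q]
⊆ k[x][1/Q]` (`Q = 1 − 3sA + A²η`), the isomorphism carrying `F/1 ↦ ψ_T F` (the twisted chart
`JordanFour.twistedChart`, p499121), `(g_jt)/(T′t) ↦ q_j/Q` (`q = JordanFour.twistedCofactor`) and
`θ ↦ Q`. One line over res-L1-w45c-stub-2's engine `exists_ringEquiv_of_twistData` once its eleven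
hypotheses are discharged (module docstring). [OURS · L1 W4.5c] -/
theorem exists_chartT_ringEquiv_twistedChart (h2 : (2 : k) ≠ 0) (h3 : (3 : k) ≠ 0)
    (C : Type) [CommRing C] [Algebra BT C] [IsLocalization.Away θT C] :
    ∃ e : C ≃+* EQ,
      (∀ F : MvPolynomial (Fin n) k,
        ((e ((algebraMap BT C : BT →+* C) (reesChartBase (I := I6) (tPrime k n a b c d)
          (tPrime_mem_I6 k n a b c d) F)) : EQ) : LQ) =
          algebraMap (MvPolynomial (Fin n) k) LQ (twistedChart k n a b c d F)) ∧
      (∀ j : Fin 8,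
        ((e ((algebraMap BT C : BT →+* C) (HomogeneousLocalization.Away.mk (reesGrading I6)
          (reesT_mem (tPrime k n a b c d) (tPrime_mem_I6 k n a b c d)) 1
          (reesT (gI6 j) (Ideal.mem_span_range_self (f := gI6) (x := j))) (reesT_mem_one_smul gI6 j))) :
            EQ) : LQ) =
          algebraMap (MvPolynomial (Fin n) k) LQ (twistedCofactor k n a b c d j) *
            IsLocalization.Away.invSelf Qp) ∧
      ((e ((algebraMap BT C : BT →+* C) (θT : BT)) : EQ) : LQ) = algebraMap (MvPolynomial (Fin n) k) LQ Qp := by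
  have hQ := twistedQ_eq_engineQ k n a b d
  have hE := adjoin_engineGens_eq_adjoin_evenGens k n a b c
  refine exists_ringEquiv_of_twistData k n a b c d gI6 (tPrime k n a b c d) (tPrime_mem_I6 k n a b c d)
    (hPrime k n a b c ^ 3) (hPrime_cube_mem_I6_sq k n a b c) had hbd hcd (twistedChart k n a b c d)
    (twistedChart_injective k n a b c d hab hac had hbc hbd hcd h2 h3) ?_ ?_ (twistedCofactor k n a b c d)
    ?_ ?_ ?_ ?_ ?_ C
  · -- `ψ_T T′ = s⁶Q` (T-iii)
    rw [twistedChart_tPrime k n a b c d hab hac had hbc hbd hcd h2 h3, hQ]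
  · -- `ψ_T H′³ = Q (s⁶Q)²` (T-iii)
    rw [map_pow, twistedChart_hPrime k n a b c d hab hac hbc h2, hQ]; ring
  · -- `ψ_T g_j = s⁶ q_j` (T-iv)
    intro j
    exact twistedChart_I6 k n a b c d hab hac hbc j
  · -- the `q_j` are even
    intro j
    rw [hE]
    exact twistedCofactor_mem_adjoin_evenGens k n a b c d hab hac had hbc hbd hcd h2 j
  · -- the `ψ_T xᵢ` are even
    intro i
    rw [hE]
    exact twistedChart_mem_adjoin_evenGens k n a b c d hab hac had hbc hbd hcd h2 (X i)
  · -- passengers are fixed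
    intro i hia hib hic hid
    exact twistedChart_X_of_ne k n a b c d i hia hib hic hid
  · -- the inverse dictionary
    have hT : tPrime k n a b c d ∈ I6 := tPrime_mem_I6 k n a b c d
    have h0 : (X a ^ 2 : MvPolynomial (Fin n) k) ∈ I6 := Ideal.subset_span ⟨0, rfl⟩
    have hHsq := I6Table.mem1_Hsq k n a b c
    have hxaH := I6Table.mem1_xaH k n a b c
    have hMH := I6Table.mem1_MH k n a b c d
    have hxaM := I6Table.mem1_xaM k n a b c d
    have hMsq := I6Table.mem1_Msq k n a b c d
    have hΔ := I6Table.mem2_Delta7 k n a b c d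
    have hmul2 : ∀ u v : MvPolynomial (Fin n) k, u ∈ I6 → v ∈ I6 → u * v ∈ I6 ^ 2 :=
      fun u v hu hv => by rw [pow_two]; exact Ideal.mul_mem_mul hu hv
    have eT := twistedChart_tPrime k n a b c d hab hac had hbc hbd hcd h2 h3
    have eH := twistedChart_hPrime k n a b c d hab hac hbc h2
    have eM := twistedChart_mSlice k n a b c d hab hac had hbc hbd hcd h2 h3
    have eΔ := twistedChart_delta7 k n a b c d hab hac had hbc hbd hcd h2 h3
    have eA := twistedChart_X_a k n a b c d
    intro t ht
    simp only [Set.mem_insert_iff, Set.mem_singleton_iff] at ht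
    rcases ht with rfl | rfl | rfl | rfl | rfl | rfl | rfl
    · -- `s²` ↤ `T′·H′² ∈ I₆²`: `ψ_T(T′H′²) = s¹⁴Q³ = s²·(s⁶Q)²·Q`
      refine ⟨2, 1, 0, tPrime k n a b c d * hPrime k n a b c ^ 2, hmul2 _ _ hT hHsq, ?_⟩
      rw [map_mul, map_pow, eT, eH, hQ]; ring
    · -- `sA` ↤ `(x_aH′)·T′ ∈ I₆²`: `ψ_T = s¹³AQ²`
      refine ⟨2, 0, 0, X a * hPrime k n a b c * tPrime k n a b c d, hmul2 _ _ hxaH hT, ?_⟩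
      rw [map_mul, map_mul, eT, eH, eA, hQ]; ring
    · -- `sξ` ↤ `(MH′)·T′ ∈ I₆²`: `ψ_T = ξs¹³Q³`
      refine ⟨2, 1, 0, mSlice k n a b c d * hPrime k n a b c * tPrime k n a b c d, hmul2 _ _ hMH hT, ?_⟩
      rw [map_mul, map_mul, eT, eH, eM, hQ]; ring
    · -- `A²` ↤ `x_a² ∈ I₆` (with `e′ = 1`): `ψ_T(x_a²)·Q = A²·(s⁶Q)`
      refine ⟨1, 0, 1, X a ^ 2, by rw [pow_one]; exact h0, ?_⟩
      rw [map_pow, eA]; ring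
    · -- `Aξ` ↤ `x_aM ∈ I₆`: `ψ_T = Aξ·s⁶Q`
      refine ⟨1, 0, 0, X a * mSlice k n a b c d, by rw [pow_one]; exact hxaM, ?_⟩
      rw [map_mul, eA, eM, hQ]; ring
    · -- `ξ²` ↤ `M² ∈ I₆`: `ψ_T = ξ²·s⁶Q²`
      refine ⟨1, 1, 0, mSlice k n a b c d ^ 2, by rw [pow_one]; exact hMsq, ?_⟩
      rw [map_pow, eM, hQ]; ring
    · -- `η` ↤ `Δ₇ ∈ I₆²`: `ψ_T Δ₇ = s¹²Q³η` (the `hψΔ` content)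
      refine ⟨2, 1, 0, delta7 k n a b c d, hΔ, ?_⟩
      rw [eΔ, hQ]; ring

/-! ## The specialisation to the sections over `W_T = D₊(T′t · H′³t²)` -/

/-- Along Mathlib's `awayMap : (R[It])_{(at)} → (R[It])_{(at·g)}` the base element `r/1`
(`reesChartBase`) goes to the degree-`0` element `r/1` (`fromZeroRingHom ∘ zeroRingHom`). [folklore] -/
theorem awayMap_reesChartBase {R : Type*} [CommRing R] {I : Ideal R} (r₀ : R) (hr₀ : r₀ ∈ I)
    {g x : reesAlgebra I} {m : ℕ} (hg : g ∈ reesGrading I m) (hx : x = reesT r₀ hr₀ * g) (r : R) :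
    HomogeneousLocalization.awayMap (reesGrading I) hg hx (reesChartBase r₀ hr₀ r) =
      HomogeneousLocalization.fromZeroRingHom (reesGrading I) _ (reesGrading.zeroRingHom I r) := by
  rw [reesChartBase, RingHom.comp_apply, HomogeneousLocalization.awayMap_fromZeroRingHom]


/-- Mathlib's localisation element `(H′³t²)^1/(T′t)^2` of `Away.isLocalization_mul` IS `θ`.
[folklore] -/
theorem isLocalizationElem_eq_theta :
    HomogeneousLocalization.Away.isLocalizationElem (𝒜 := reesGrading I6)
        (reesT_mem (tPrime k n a b c d) (tPrime_mem_I6 k n a b c d)) (hCubeT2_mem k n a b c) =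
      (θT : BT) := by
  unfold HomogeneousLocalization.Away.isLocalizationElem
  congr 1
  exact pow_one _

/-- **`(k[x][I₆t])_{(T′t·H′³t²)}` is a localisation of `B_T` at `θ`** along Mathlib's
`HomogeneousLocalization.awayMap` (`Away.isLocalization_mul`, degrees `1` and `2`). [folklore] -/
theorem isLocalization_away_theta_chartW :
    letI := (HomogeneousLocalization.awayMap (reesGrading I6) (hCubeT2_mem k n a b c)
      (rfl : reesT (tPrime k n a b c d) (tPrime_mem_I6 k n a b c d) * hCubeT2 k n a b c = _)).toAlgebra
    IsLocalization.Away (θT : BT) BW := by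
  rw [← isLocalizationElem_eq_theta]
  exact HomogeneousLocalization.Away.isLocalization_mul (𝒜 := reesGrading I6)
    (reesT_mem (tPrime k n a b c d) (tPrime_mem_I6 k n a b c d)) (hCubeT2_mem k n a b c) rfl one_ne_zero

include hab hac had hbc hbd hcd in
/-- **T2(b) on `W_T`.** The homogeneous localisation `(k[x][I₆t])_{(T′t·H′³t²)}` — the ring of
sections of `Bl_{I₆} 𝔸ⁿ` over `JordanFour.chartW = D₊(T′t·H′³t²)` (Mathlib `Proj.basicOpenIsoAway`;
the seam of res-type-036 / res-L1-w45c-stub-5) — is `≃+* E_Q`, with `F/1 ↦ ψ_T F` for the degree-`0`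
elements `fromZeroRingHom (zeroRingHom F)`, the images of the `T′`-chart ratios `(g_jt)/(T′t) ↦ q_j/Q`,
and `θ ↦ Q`. [OURS · L1 W4.5c] -/
theorem exists_chartW_away_ringEquiv_twistedChart (h2 : (2 : k) ≠ 0) (h3 : (3 : k) ≠ 0) :
    ∃ e : BW ≃+* EQ,
      (∀ F : MvPolynomial (Fin n) k,
        ((e (HomogeneousLocalization.fromZeroRingHom (reesGrading I6) _
          (reesGrading.zeroRingHom I6 F)) : EQ) : LQ) =
          algebraMap (MvPolynomial (Fin n) k) LQ (twistedChart k n a b c d F)) ∧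
      (∀ j : Fin 8,
        ((e (HomogeneousLocalization.awayMap (reesGrading I6) (hCubeT2_mem k n a b c)
          (rfl : reesT (tPrime k n a b c d) (tPrime_mem_I6 k n a b c d) * hCubeT2 k n a b c = _)
          (HomogeneousLocalization.Away.mk (reesGrading I6)
            (reesT_mem (tPrime k n a b c d) (tPrime_mem_I6 k n a b c d)) 1
            (reesT (gI6 j) (Ideal.mem_span_range_self (f := gI6) (x := j))) (reesT_mem_one_smul gI6 j))) :
            EQ) : LQ) =
          algebraMap (MvPolynomial (Fin n) k) LQ (twistedCofactor k n a b c d j) *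
            IsLocalization.Away.invSelf Qp) ∧
      ((e (HomogeneousLocalization.awayMap (reesGrading I6) (hCubeT2_mem k n a b c)
          (rfl : reesT (tPrime k n a b c d) (tPrime_mem_I6 k n a b c d) * hCubeT2 k n a b c = _)
          (θT : BT)) : EQ) : LQ) = algebraMap (MvPolynomial (Fin n) k) LQ Qp := by
  -- the `B_T`-algebra structure on `B_W` along `awayMap` (explicit, to keep instance search cheap)
  letI := (HomogeneousLocalization.awayMap (reesGrading I6) (hCubeT2_mem k n a b c)
      (rfl : reesT (tPrime k n a b c d) (tPrime_mem_I6 k n a b c d) * hCubeT2 k n a b c = _)).toAlgebra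
  have hmain := @exists_chartT_ringEquiv_twistedChart k _ n a b c d hab hac had hbc hbd hcd h2 h3 BW _
    ((HomogeneousLocalization.awayMap (reesGrading I6) (hCubeT2_mem k n a b c)
      (rfl : reesT (tPrime k n a b c d) (tPrime_mem_I6 k n a b c d) * hCubeT2 k n a b c = _)).toAlgebra)
    (isLocalization_away_theta_chartW k n a b c d)
  obtain ⟨e, h1, h2', h3'⟩ := hmain
  refine ⟨e, fun F => ?_, fun j => h2' j, h3'⟩
  rw [← awayMap_reesChartBase (tPrime k n a b c d) (tPrime_mem_I6 k n a b c d) (hCubeT2_mem k n a b c)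
    (rfl : reesT (tPrime k n a b c d) (tPrime_mem_I6 k n a b c d) * hCubeT2 k n a b c = _) F]
  exact h1 F

end Summit.ResolutionOfSingularities.ResolutionOfSingularities.Theorems.WildQuotientResolution.JordanFour

end
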